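import Summits.ResolutionOfSingularities.ResolutionOfSingularities.Theorems.EquisingularLiftEquisingularLiftNatSpecialFibreCharts
import Summits.ResolutionOfSingularities.ResolutionOfSingularities.Theorems.EquisingularLiftEquisingularLiftNatEmbeddedInfinitesimalLiftOfCharts
import Summits.ResolutionOfSingularities.ResolutionOfSingularities.Theorems.EquisingularLiftEquisingularLiftNatRegularSequenceRestrict
import Summits.ResolutionOfSingularities.ResolutionOfSingularities.Theorems.EquisingularLiftEquisingularLiftNatInfinitesimalFibreCharts
import Mathlib.RingTheory.TensorProduct.Quotient
import Mathlib.RingTheory.Flat.Stability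
import HarnessLib

/-!
# [OURS · L1 W4.5(b) · EL♮(3) · J1c (π) brick F6a] Chart lifts on the infinitesimal neighbourhood: the scheme-level chart data

Crux chain w45b (cell `res-hironaka`, slot W4.5(b)), child crux **EL♮(3)** = stmt-ResolutionOfSingularities-20148; J1 = `EmbeddedInfinitesimalLiftFact`
(p596985), discharge programme J1c, brick **(π)** (patching engine, res-type-027 g17). OURS; NOT a statement of H. Hironaka's 2017 manuscript; AI-written,
gate-checked, weaker than expert review. No `sorry`; standard axioms. Definitions `chartAlg` (the `A/I^{n+2}`-algebra structure of a chart ring of `X_{n+1}`),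
`resAlgHom` (restriction as an algebra map), `traceHom` (the chart trace map onto the special fibre), `IsChartLift` (review lane). `--supports stmt-ResolutionOfSingularities-20148 --as helper`.

SETTING (general tower; J1 is `A = O` a DVR, `I = 𝔪`, `q = θ`): `f : X ⟶ Spec A`, `I ⊆ A`, a level `n`; `X' := X_{n+1} = infinitesimalNeighbourhood I f (n+1)` with
`p := toSpec : X' → Spec (A/I^{n+2})` and the transition `t : X_n ↪ X'`; a closed `jn : Y_n ↪ X_n`; a fibre model `(j₀, t₀)` of `f` over `q : A ↠ k₀`
(`IsPullback j₀ t₀ f (Spec q)`), `ι : Y₀ ↪ X₀` with `Y₀ = Y_n ×_X X₀` (`hs₀`); `e₀ := fibreEmb n ≫ t : X₀ ↪ X'` (F5a).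
* `chartAlg m U`: `Γ(X_m, U)` (`U` affine) is an `A/I^{m+1}`-algebra through `toSpec♯ ∘ ΓSpecIso⁻¹`; `resAlgHom`: restrictions are algebra maps;
  `app_transition_comp_algebraMap`: `t♯_U` intertwines the structure maps of levels `n+1` and `n`;
* `ker_app_transition_eq_span` (D1, stub-4 p-file …NatTransitionKernelCharts, in this currency): `ker (t♯_U) = (ε)` when `ker (A/I^{n+2} → A/I^{n+1}) = (ε)`;
  `traceHom U = (fibreEmb n)♯_{t⁻¹U} ∘ t♯_U` (the special fibre through the chart, `e₀ = fibreEmb n ≫ t`, written as a composite of RING maps so that all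
  section rings are indexed by iterated preimages), `traceHom_surjective`, `ker_traceHom` (`= 𝔪·Γ(X', U)`, `𝔪 := (ker q)/I^{n+2}`), `traceHom_res`;
* `IsChartLift U J` — **a chart lift**: `Γ(X', U)/J` flat over `A/I^{n+2}` and `J·Γ(X_n, t⁻¹U) = ker (jn♯_{t⁻¹U})` (the chart clause of (β) p603689);
  consequences: `IsChartLift.sup_span_eq` (`J + (ε) = (ker jn♯)♯⁻¹`, so two chart lifts are comparable), `IsChartLift.map_traceHom` (D4:
  `π_U(J) = 𝓘_{Y₀}(fibreEmb⁻¹(t⁻¹U))`), `isChartLift_of_sup_span_eq` (a flat `J'` with `J' + (ε) = J + (ε)` is again a chart lift), `IsChartLift.restrict` (L0: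
  chart lifts restrict to smaller affine opens — flatness by `flat_quotient_map_of_flat` and `flat_presheaf_map`, the clause by naturality of `t♯`).
This is exactly the input format of the abstract chart torsor F5 (`A' := Γ(X', U)`, `π := traceHom U`, `V := fibreEmb⁻¹(t⁻¹U)`) used by the patching F6b.
(Kernel note: no statement mentions the scheme composite `fibreEmb n ≫ t` — comparing its preimages with iterated preimages makes the kernel unfold `fibreEmb`.)

References (method / index only): R. Hartshorne, *Deformation Theory* (2010), §6; U. Görtz–T. Wedhorn, *Algebraic Geometry I*, Example 4.36.
-/

set_option linter.dupNamespace false -- mandated namespace `Summit.<Summit>.<Problem>` of this single-conjunct summit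
-- `TopCat.Presheaf`/`Scheme.Modules` are not reducible (as in Mathlib's `AlgebraicGeometry/Modules` and the tree's `Modules/*`).
set_option backward.isDefEq.respectTransparency false

noncomputable section

open CategoryTheory CategoryTheory.Limits AlgebraicGeometry Opposite TopologicalSpace
open Literature.AlgebraicGeometry.Morphisms

namespace Summit.ResolutionOfSingularities.ResolutionOfSingularities.Cruxes.EquisingularLiftNat.Sections

/-! ## Pure algebra -/

/-- **Flatness of `B/JB` over `R` from flatness of `B` over `A` and of `A/J` over `R`** (`B/JB ≅ (A/J) ⊗_A B` is flat over `A/J`, then transitivity).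
[folklore] -/
theorem flat_quotient_map_of_flat {R A B : Type*} [CommRing R] [CommRing A] [CommRing B] [Algebra R A] [Algebra R B] [Algebra A B]
    [IsScalarTower R A B] [Module.Flat A B] (J : Ideal A) [Module.Flat R (A ⧸ J)] : Module.Flat R (B ⧸ J.map (algebraMap A B)) := by
  haveI : Module.Flat (A ⧸ J) (B ⧸ J.map (algebraMap A B)) :=
    Module.Flat.of_linearEquiv (Algebra.TensorProduct.quotIdealMapEquivQuotTensor B J).toLinearEquiv
  haveI : IsScalarTower R (A ⧸ J) (B ⧸ J.map (algebraMap A B)) :=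
    IsScalarTower.of_algebraMap_eq fun r => by
      rw [IsScalarTower.algebraMap_apply R A (A ⧸ J), Ideal.Quotient.algebraMap_eq, Ideal.Quotient.algebraMap_quotient_map_quotient,
        IsScalarTower.algebraMap_apply R B (B ⧸ J.map (algebraMap A B)), Ideal.Quotient.algebraMap_eq, IsScalarTower.algebraMap_apply R A B]
  exact Module.Flat.trans R (A ⧸ J) (B ⧸ J.map (algebraMap A B))

/-- If `J' + L = J + L` and `L ≤ ker g` then `J'` and `J` have the same image under `g`. [folklore] -/
theorem map_eq_map_of_sup_eq {A' B : Type*} [CommRing A'] [CommRing B] (g : A' →+* B) {J J' L : Ideal A'} (hL : L ≤ RingHom.ker g)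
    (h : J' ⊔ L = J ⊔ L) : J'.map g = J.map g := by
  have hL0 : L.map g = ⊥ := (Ideal.map_eq_bot_iff_le_ker g).mpr hL
  have e1 : J'.map g = (J' ⊔ L).map g := by rw [Ideal.map_sup, hL0, sup_bot_eq]
  have e2 : J.map g = (J ⊔ L).map g := by rw [Ideal.map_sup, hL0, sup_bot_eq]
  rw [e1, e2, h]

/-- Sections of a composite of morphisms of schemes, as a composite of ring maps (generic form, so that the kernel never unfolds the morphisms).
[folklore] -/
theorem hom_app_comp {Y Z W : Scheme.{0}} (a : Y ⟶ Z) (b : Z ⟶ W) (U : W.Opens) :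
    ((a ≫ b).app U).hom = (a.app (b ⁻¹ᵁ U)).hom.comp (b.app U).hom := by
  rw [Scheme.Hom.comp_app, CommRingCat.hom_comp]

/-! ## The chart algebra structure -/

section Chart

variable {A : Type} [CommRing A] (I : Ideal A) {X : Scheme.{0}} (f : X ⟶ Spec (.of A))

/-- **The `A/I^{m+1}`-algebra structure of the chart ring `Γ(X_m, U)`** (`U ⊆ X_m` affine): through `p♯ : Γ(Spec, ⊤) → Γ(X_m, U)` composed with
`ΓSpecIso⁻¹ : A/I^{m+1} ≅ Γ(Spec (A/I^{m+1}), ⊤)` (a reducible definition, used through `letI`). [folklore] -/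
@[reducible]
def chartAlg (m : ℕ) (U : (infinitesimalNeighbourhood I f m).affineOpens) : Algebra (A ⧸ I ^ (m + 1)) Γ(infinitesimalNeighbourhood I f m, U) :=
  (((infinitesimalNeighbourhood.toSpec I f m).appLE ⊤ U le_top).hom.comp (Scheme.ΓSpecIso (.of (A ⧸ I ^ (m + 1)))).inv.hom).toAlgebra

/-- The structure map of `chartAlg`. [folklore] -/
theorem algebraMap_chartAlg (m : ℕ) (U : (infinitesimalNeighbourhood I f m).affineOpens) :
    (letI := chartAlg I f m U; algebraMap (A ⧸ I ^ (m + 1)) Γ(infinitesimalNeighbourhood I f m, U)) =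
      ((infinitesimalNeighbourhood.toSpec I f m).appLE ⊤ U le_top).hom.comp (Scheme.ΓSpecIso (.of (A ⧸ I ^ (m + 1)))).inv.hom :=
  rfl

/-- The structure map of `chartAlg`, through `appTop` and restriction. [folklore] -/
theorem algebraMap_chartAlg_eq_map_comp (m : ℕ) (U : (infinitesimalNeighbourhood I f m).affineOpens) :
    (letI := chartAlg I f m U; algebraMap (A ⧸ I ^ (m + 1)) Γ(infinitesimalNeighbourhood I f m, U)) =
      ((infinitesimalNeighbourhood I f m).presheaf.map (homOfLE (le_top : (U : (infinitesimalNeighbourhood I f m).Opens) ≤ ⊤)).op).hom.comp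
        (((infinitesimalNeighbourhood.toSpec I f m).appTop).hom.comp (Scheme.ΓSpecIso (.of (A ⧸ I ^ (m + 1)))).inv.hom) := by
  rw [algebraMap_chartAlg, ← RingHom.comp_assoc, ← CommRingCat.hom_comp]
  rfl

/-- Restriction to a smaller affine open commutes with the structure maps. [folklore] -/
theorem res_comp_algebraMap_chartAlg (m : ℕ) {U U' : (infinitesimalNeighbourhood I f m).affineOpens}
    (h : (U' : (infinitesimalNeighbourhood I f m).Opens) ≤ U) :
    ((infinitesimalNeighbourhood I f m).presheaf.map (homOfLE h).op).hom.comp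
        (letI := chartAlg I f m U; algebraMap (A ⧸ I ^ (m + 1)) Γ(infinitesimalNeighbourhood I f m, U)) =
      (letI := chartAlg I f m U'; algebraMap (A ⧸ I ^ (m + 1)) Γ(infinitesimalNeighbourhood I f m, U')) := by
  rw [algebraMap_chartAlg, algebraMap_chartAlg, ← RingHom.comp_assoc, ← CommRingCat.hom_comp, Scheme.Hom.appLE_map]

/-- **Restriction `Γ(X_m, U) → Γ(X_m, U')` as a map of `A/I^{m+1}`-algebras** (`U' ≤ U` affine). [folklore] -/
def resAlgHom (m : ℕ) {U U' : (infinitesimalNeighbourhood I f m).affineOpens} (h : (U' : (infinitesimalNeighbourhood I f m).Opens) ≤ U) :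
    letI := chartAlg I f m U; letI := chartAlg I f m U'
    Γ(infinitesimalNeighbourhood I f m, U) →ₐ[A ⧸ I ^ (m + 1)] Γ(infinitesimalNeighbourhood I f m, U') :=
  letI := chartAlg I f m U; letI := chartAlg I f m U'
  { ((infinitesimalNeighbourhood I f m).presheaf.map (homOfLE h).op).hom with
    commutes' := fun c => by
      have e := congrArg (fun g : A ⧸ I ^ (m + 1) →+* Γ(infinitesimalNeighbourhood I f m, U') => g c) (res_comp_algebraMap_chartAlg I f m h)
      exact e }

/-- `resAlgHom` is the restriction map on elements. [folklore] -/
theorem resAlgHom_apply (m : ℕ) {U U' : (infinitesimalNeighbourhood I f m).affineOpens} (h : (U' : (infinitesimalNeighbourhood I f m).Opens) ≤ U)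
    (a : Γ(infinitesimalNeighbourhood I f m, U)) :
    (letI := chartAlg I f m U; letI := chartAlg I f m U'; resAlgHom I f m h a) = (infinitesimalNeighbourhood I f m).presheaf.map (homOfLE h).op a :=
  rfl

/-- Extension along `resAlgHom` is extension along the restriction map. [folklore] -/
theorem map_resAlgHom (m : ℕ) {U U' : (infinitesimalNeighbourhood I f m).affineOpens} (h : (U' : (infinitesimalNeighbourhood I f m).Opens) ≤ U)
    (J : Ideal Γ(infinitesimalNeighbourhood I f m, U)) :
    (letI := chartAlg I f m U; letI := chartAlg I f m U'; J.map (resAlgHom I f m h)) =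
      J.map ((infinitesimalNeighbourhood I f m).presheaf.map (homOfLE h).op).hom :=
  rfl

variable (n : ℕ)

/-- **D1 in chart currency**: if `ker (A/I^{n+2} → A/I^{n+1}) = (ε)` then `ker (t♯_U) = (ε)·Γ(X_{n+1}, U)` for the transition `t : X_n ↪ X_{n+1}` and every affine
chart `U`. [cite: GortzWedhorn2020, Example 4.36 (p. 139)] -/
theorem ker_app_transition_eq_span {ε : A ⧸ I ^ (n + 1 + 1)} (hkert : RingHom.ker (infinitesimalNeighbourhood.transitionRingHom I n) = Ideal.span {ε})
    (U : (infinitesimalNeighbourhood I f (n + 1)).affineOpens) :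
    RingHom.ker ((infinitesimalNeighbourhood.transition I f n).app (U : (infinitesimalNeighbourhood I f (n + 1)).Opens)).hom =
      Ideal.span {(letI := chartAlg I f (n + 1) U; algebraMap (A ⧸ I ^ (n + 1 + 1)) Γ(infinitesimalNeighbourhood I f (n + 1), U) ε)} := by
  rw [ker_app_transition_eq_map I f n U, hkert, comap_hom_eq_map_inv, Ideal.map_map, Ideal.map_span, Set.image_singleton]
  rfl

/-- **Level compatibility of the chart algebras**: `t♯_U ∘ (structure map of Γ(X_{n+1}, U)) = (structure map of Γ(X_n, t⁻¹U)) ∘ (A/I^{n+2} → A/I^{n+1})`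
(`t ≫ toSpec_{n+1} = toSpec_n ≫ Spec (A/I^{n+2} → A/I^{n+1})` on global sections, then restriction). [folklore] -/
theorem app_transition_comp_algebraMap (U : (infinitesimalNeighbourhood I f (n + 1)).affineOpens) :
    haveI := isClosedImmersion_transition I f n
    ((infinitesimalNeighbourhood.transition I f n).app (U : (infinitesimalNeighbourhood I f (n + 1)).Opens)).hom.comp
        (letI := chartAlg I f (n + 1) U; algebraMap (A ⧸ I ^ (n + 1 + 1)) Γ(infinitesimalNeighbourhood I f (n + 1), U)) =
      (letI := chartAlg I f n ⟨(infinitesimalNeighbourhood.transition I f n) ⁻¹ᵁ (U : (infinitesimalNeighbourhood I f (n + 1)).Opens), U.2.preimage _⟩;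
        algebraMap (A ⧸ I ^ (n + 1)) Γ(infinitesimalNeighbourhood I f n, (infinitesimalNeighbourhood.transition I f n) ⁻¹ᵁ
          (U : (infinitesimalNeighbourhood I f (n + 1)).Opens))).comp (infinitesimalNeighbourhood.transitionRingHom I n) := by
  haveI := isClosedImmersion_transition I f n
  -- `t♯ ∘ toSpec♯_{n+1} = toSpec♯_n ∘ (Spec tr)♯` on global sections
  have htop : (infinitesimalNeighbourhood.toSpec I f (n + 1)).appTop ≫ (infinitesimalNeighbourhood.transition I f n).appTop =
      (Spec.map (CommRingCat.ofHom (infinitesimalNeighbourhood.transitionRingHom I n))).appTop ≫ (infinitesimalNeighbourhood.toSpec I f n).appTop := by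
    rw [← Scheme.Hom.comp_appTop, ← Scheme.Hom.comp_appTop, infinitesimalNeighbourhood.transition_toSpec]
  have hΓ := Scheme.ΓSpecIso_inv_naturality (CommRingCat.ofHom (infinitesimalNeighbourhood.transitionRingHom I n))
  -- move `t♯_U` past the restriction `⊤ → U` (naturality of `t♯`)
  have hnat := (infinitesimalNeighbourhood.transition I f n).naturality
    (homOfLE (le_top : (U : (infinitesimalNeighbourhood I f (n + 1)).Opens) ≤ ⊤)).op
  apply RingHom.ext
  intro c
  have e1 := congrArg (fun φ => φ.hom (((infinitesimalNeighbourhood.toSpec I f (n + 1)).appTop).hom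
    ((Scheme.ΓSpecIso (.of (A ⧸ I ^ (n + 1 + 1)))).inv.hom c))) hnat
  have e2 := congrArg (fun φ => φ.hom ((Scheme.ΓSpecIso (.of (A ⧸ I ^ (n + 1 + 1)))).inv.hom c)) htop
  have e3 := congrArg (fun φ => φ.hom c) hΓ
  simp only [CommRingCat.hom_comp, RingHom.comp_apply, CommRingCat.hom_ofHom] at e1 e2 e3
  -- both structure maps, unfolded on the element
  change ((infinitesimalNeighbourhood.transition I f n).app (U : (infinitesimalNeighbourhood I f (n + 1)).Opens)).hom
      (((infinitesimalNeighbourhood I f (n + 1)).presheaf.map (homOfLE (le_top : (U : (infinitesimalNeighbourhood I f (n + 1)).Opens) ≤ ⊤)).op).hom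
        (((infinitesimalNeighbourhood.toSpec I f (n + 1)).appTop).hom ((Scheme.ΓSpecIso (.of (A ⧸ I ^ (n + 1 + 1)))).inv.hom c))) =
    ((infinitesimalNeighbourhood I f n).presheaf.map (homOfLE (le_top : ((infinitesimalNeighbourhood.transition I f n) ⁻¹ᵁ
        (U : (infinitesimalNeighbourhood I f (n + 1)).Opens)) ≤ ⊤)).op).hom
      (((infinitesimalNeighbourhood.toSpec I f n).appTop).hom ((Scheme.ΓSpecIso (.of (A ⧸ I ^ (n + 1)))).inv.hom
        (infinitesimalNeighbourhood.transitionRingHom I n c)))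
  rw [e1]
  erw [e2, ← e3]
  rfl

end Chart

/-! ## Chart lifts -/

section Lift

variable {A : Type} [CommRing A] (I : Ideal A) {X : Scheme.{0}} (f : X ⟶ Spec (.of A)) (n : ℕ)
  {Yn : Scheme.{0}} (jn : Yn ⟶ infinitesimalNeighbourhood I f n)

/-- **`IsChartLift I f n jn U J` — `J ≤ Γ(X_{n+1}, U)` is a chart lift of `Y_n` on the affine chart `U`**: the quotient `Γ(X_{n+1}, U)/J` is flat over
`A/I^{n+2}` and `J·Γ(X_n, t⁻¹U) = ker (jn♯_{t⁻¹U})` (the chart clause of `EmbeddedInfinitesimalChartLiftFact`, p603689). [OURS · predicate of the (π) engine;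
NOT a statement of a source] -/
def IsChartLift (U : (infinitesimalNeighbourhood I f (n + 1)).affineOpens) (J : Ideal Γ(infinitesimalNeighbourhood I f (n + 1), U)) : Prop :=
  (letI := chartAlg I f (n + 1) U; Module.Flat (A ⧸ I ^ (n + 1 + 1)) (Γ(infinitesimalNeighbourhood I f (n + 1), U) ⧸ J)) ∧
    J.map ((infinitesimalNeighbourhood.transition I f n).app (U : (infinitesimalNeighbourhood I f (n + 1)).Opens)).hom =
      RingHom.ker (jn.app ((infinitesimalNeighbourhood.transition I f n) ⁻¹ᵁ (U : (infinitesimalNeighbourhood I f (n + 1)).Opens))).hom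

variable {I f n jn}

/-- The flatness half of a chart lift. [folklore] -/
theorem IsChartLift.flat {U : (infinitesimalNeighbourhood I f (n + 1)).affineOpens} {J : Ideal Γ(infinitesimalNeighbourhood I f (n + 1), U)}
    (h : IsChartLift I f n jn U J) : letI := chartAlg I f (n + 1) U; Module.Flat (A ⧸ I ^ (n + 1 + 1)) (Γ(infinitesimalNeighbourhood I f (n + 1), U) ⧸ J) :=
  h.1

/-- The chart clause of a chart lift. [folklore] -/
theorem IsChartLift.map_app_transition {U : (infinitesimalNeighbourhood I f (n + 1)).affineOpens} {J : Ideal Γ(infinitesimalNeighbourhood I f (n + 1), U)}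
    (h : IsChartLift I f n jn U J) :
    J.map ((infinitesimalNeighbourhood.transition I f n).app (U : (infinitesimalNeighbourhood I f (n + 1)).Opens)).hom =
      RingHom.ker (jn.app ((infinitesimalNeighbourhood.transition I f n) ⁻¹ᵁ (U : (infinitesimalNeighbourhood I f (n + 1)).Opens))).hom :=
  h.2

/-- **`J + (ε) = (ker jn♯)♯⁻¹`**: a chart lift together with the kernel `(ε)` of `t♯_U` is the preimage of the ideal of `Y_n` (so ANY two chart lifts on `U`
satisfy `J ≤ J' + (ε)`). [folklore] -/
theorem IsChartLift.sup_span_eq {ε : A ⧸ I ^ (n + 1 + 1)} (hkert : RingHom.ker (infinitesimalNeighbourhood.transitionRingHom I n) = Ideal.span {ε})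
    {U : (infinitesimalNeighbourhood I f (n + 1)).affineOpens} {J : Ideal Γ(infinitesimalNeighbourhood I f (n + 1), U)} (h : IsChartLift I f n jn U J) :
    J ⊔ Ideal.span {(letI := chartAlg I f (n + 1) U; algebraMap (A ⧸ I ^ (n + 1 + 1)) Γ(infinitesimalNeighbourhood I f (n + 1), U) ε)} =
      (RingHom.ker (jn.app ((infinitesimalNeighbourhood.transition I f n) ⁻¹ᵁ (U : (infinitesimalNeighbourhood I f (n + 1)).Opens))).hom).comap
        ((infinitesimalNeighbourhood.transition I f n).app (U : (infinitesimalNeighbourhood I f (n + 1)).Opens)).hom := by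
  haveI := isClosedImmersion_transition I f n
  rw [← h.2, Ideal.comap_map_of_surjective _ ((infinitesimalNeighbourhood.transition I f n).app_surjective _ U.2), ← RingHom.ker_eq_comap_bot,
    ker_app_transition_eq_span I f n hkert U]

/-- Two chart lifts on the same chart are comparable: `J ≤ J' + (ε)`. [folklore] -/
theorem IsChartLift.le_sup_span {ε : A ⧸ I ^ (n + 1 + 1)} (hkert : RingHom.ker (infinitesimalNeighbourhood.transitionRingHom I n) = Ideal.span {ε})
    {U : (infinitesimalNeighbourhood I f (n + 1)).affineOpens} {J J' : Ideal Γ(infinitesimalNeighbourhood I f (n + 1), U)}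
    (h : IsChartLift I f n jn U J) (h' : IsChartLift I f n jn U J') :
    J ≤ J' ⊔ Ideal.span {(letI := chartAlg I f (n + 1) U; algebraMap (A ⧸ I ^ (n + 1 + 1)) Γ(infinitesimalNeighbourhood I f (n + 1), U) ε)} := by
  rw [h'.sup_span_eq hkert, ← h.sup_span_eq hkert]
  exact le_sup_left

/-- **A flat ideal with the same reduction modulo `ε` as a chart lift is a chart lift.** [folklore] -/
theorem isChartLift_of_sup_span_eq {ε : A ⧸ I ^ (n + 1 + 1)} (hkert : RingHom.ker (infinitesimalNeighbourhood.transitionRingHom I n) = Ideal.span {ε})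
    {U : (infinitesimalNeighbourhood I f (n + 1)).affineOpens} {J J' : Ideal Γ(infinitesimalNeighbourhood I f (n + 1), U)} (h : IsChartLift I f n jn U J)
    (hflat : letI := chartAlg I f (n + 1) U; Module.Flat (A ⧸ I ^ (n + 1 + 1)) (Γ(infinitesimalNeighbourhood I f (n + 1), U) ⧸ J'))
    (hsup : J' ⊔ Ideal.span {(letI := chartAlg I f (n + 1) U; algebraMap (A ⧸ I ^ (n + 1 + 1)) Γ(infinitesimalNeighbourhood I f (n + 1), U) ε)} =
      J ⊔ Ideal.span {(letI := chartAlg I f (n + 1) U; algebraMap (A ⧸ I ^ (n + 1 + 1)) Γ(infinitesimalNeighbourhood I f (n + 1), U) ε)}) :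
    IsChartLift I f n jn U J' := by
  refine ⟨hflat, ?_⟩
  rw [← h.2]
  refine map_eq_map_of_sup_eq _ ?_ hsup
  rw [ker_app_transition_eq_span I f n hkert U]

/-- **L0. Chart lifts restrict to smaller affine charts**: `J·Γ(X_{n+1}, U')` is a chart lift on `U' ≤ U` (flatness: `Γ(U')` is flat over `Γ(U)`, B3
`flat_presheaf_map`, and `flat_quotient_map_of_flat`; chart clause: naturality of `t♯` and of the ideal sheaf `jn.ker`). [folklore] -/
theorem IsChartLift.restrict [IsClosedImmersion jn] {U U' : (infinitesimalNeighbourhood I f (n + 1)).affineOpens}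
    (hle : (U' : (infinitesimalNeighbourhood I f (n + 1)).Opens) ≤ U) {J : Ideal Γ(infinitesimalNeighbourhood I f (n + 1), U)} (h : IsChartLift I f n jn U J) :
    IsChartLift I f n jn U' (J.map ((infinitesimalNeighbourhood I f (n + 1)).presheaf.map (homOfLE hle).op).hom) := by
  constructor
  · letI := chartAlg I f (n + 1) U
    letI := chartAlg I f (n + 1) U'
    letI : Algebra Γ(infinitesimalNeighbourhood I f (n + 1), U) Γ(infinitesimalNeighbourhood I f (n + 1), U') :=
      ((infinitesimalNeighbourhood I f (n + 1)).presheaf.map (homOfLE hle).op).hom.toAlgebra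
    haveI : IsScalarTower (A ⧸ I ^ (n + 1 + 1)) Γ(infinitesimalNeighbourhood I f (n + 1), U) Γ(infinitesimalNeighbourhood I f (n + 1), U') :=
      IsScalarTower.of_algebraMap_eq fun c =>
        (congrArg (fun g : A ⧸ I ^ (n + 1 + 1) →+* Γ(infinitesimalNeighbourhood I f (n + 1), U') => g c) (res_comp_algebraMap_chartAlg I f (n + 1) hle)).symm
    haveI : Module.Flat Γ(infinitesimalNeighbourhood I f (n + 1), U) Γ(infinitesimalNeighbourhood I f (n + 1), U') := flat_presheaf_map hle
    haveI := h.1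
    exact flat_quotient_map_of_flat (R := A ⧸ I ^ (n + 1 + 1)) J
  · haveI : IsAffineHom (infinitesimalNeighbourhood.transition I f n) := by
      haveI := isClosedImmersion_transition I f n; infer_instance
    -- naturality of `t♯`, then the chart clause on `U` and the restriction property of `jn.ker`
    have hnat := (infinitesimalNeighbourhood.transition I f n).naturality (homOfLE hle).op
    have hnat' : ((infinitesimalNeighbourhood.transition I f n).app (U' : (infinitesimalNeighbourhood I f (n + 1)).Opens)).hom.comp
        ((infinitesimalNeighbourhood I f (n + 1)).presheaf.map (homOfLE hle).op).hom =
        ((infinitesimalNeighbourhood I f n).presheaf.map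
          ((Opens.map (infinitesimalNeighbourhood.transition I f n).base).map (homOfLE hle).op.unop).op).hom.comp
          ((infinitesimalNeighbourhood.transition I f n).app (U : (infinitesimalNeighbourhood I f (n + 1)).Opens)).hom := by
      rw [← CommRingCat.hom_comp, ← CommRingCat.hom_comp, hnat]
    have e1 := ker_ideal_chart (infinitesimalNeighbourhood.transition I f n) jn U
    have e2 := ker_ideal_chart (infinitesimalNeighbourhood.transition I f n) jn U'
    rw [Ideal.map_map, hnat', ← Ideal.map_map, h.2, ← e1, ← e2]
    exact jn.ker.map_ideal'
      (U := ⟨(infinitesimalNeighbourhood.transition I f n) ⁻¹ᵁ (U' : (infinitesimalNeighbourhood I f (n + 1)).Opens), U'.2.preimage _⟩)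
      (V := ⟨(infinitesimalNeighbourhood.transition I f n) ⁻¹ᵁ (U : (infinitesimalNeighbourhood I f (n + 1)).Opens), U.2.preimage _⟩)
      (((Opens.map (infinitesimalNeighbourhood.transition I f n).base).map (homOfLE hle).op.unop).op)

end Lift

/-! ## The special fibre through the charts: `π_U := (fibreEmb n)♯_{t⁻¹U} ∘ t♯_U` -/

section SpecialFibre

variable {A : Type} [CommRing A] (I : Ideal A) {X : Scheme.{0}} (f : X ⟶ Spec (.of A)) (n : ℕ) {k₀ : Type} [CommRing k₀] (q : A →+* k₀)
  (hq : Function.Surjective q) (hI : I ≤ RingHom.ker q) {X₀ : Scheme.{0}} {j₀ : X₀ ⟶ X} {t₀ : X₀ ⟶ Spec (.of k₀)}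
  (hsq : IsPullback j₀ t₀ f (Spec.map (CommRingCat.ofHom q)))

/-- **The trace map `π_U : Γ(X_{n+1}, U) → Γ(X₀, e₀⁻¹U)`** of an affine chart onto the corresponding chart of the special fibre, `e₀ = fibreEmb n ≫ t`,
written as the composite of ring maps `(fibreEmb n)♯_{t⁻¹U} ∘ t♯_U` (so that every section ring is indexed by an iterated preimage). [folklore] -/
def traceHom (U : (infinitesimalNeighbourhood I f (n + 1)).affineOpens) :
    Γ(infinitesimalNeighbourhood I f (n + 1), U) →+*
      Γ(X₀, fibreEmb I f q hI hsq n ⁻¹ᵁ ((infinitesimalNeighbourhood.transition I f n) ⁻¹ᵁ (U : (infinitesimalNeighbourhood I f (n + 1)).Opens))) :=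
  ((fibreEmb I f q hI hsq n).app ((infinitesimalNeighbourhood.transition I f n) ⁻¹ᵁ (U : (infinitesimalNeighbourhood I f (n + 1)).Opens))).hom.comp
    ((infinitesimalNeighbourhood.transition I f n).app (U : (infinitesimalNeighbourhood I f (n + 1)).Opens)).hom

/-- Unfolding `traceHom`. [folklore] -/
theorem traceHom_apply (U : (infinitesimalNeighbourhood I f (n + 1)).affineOpens) (a : Γ(infinitesimalNeighbourhood I f (n + 1), U)) :
    traceHom I f n q hI hsq U a = (fibreEmb I f q hI hsq n).app _ ((infinitesimalNeighbourhood.transition I f n).app _ a) :=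
  rfl

include hq in
/-- `π_U` is surjective (both factors are sections of closed immersions over affine opens). [folklore] -/
theorem traceHom_surjective (U : (infinitesimalNeighbourhood I f (n + 1)).affineOpens) : Function.Surjective (traceHom I f n q hI hsq U) := by
  haveI := isClosedImmersion_fibreEmb I f q hI hsq hq n
  haveI := isClosedImmersion_transition I f n
  exact ((fibreEmb I f q hI hsq n).app_surjective _ (U.2.preimage _)).comp ((infinitesimalNeighbourhood.transition I f n).app_surjective _ U.2)

include hq in
/-- **`ker π_U = 𝔪·Γ(X_{n+1}, U)`**, `𝔪 = (ker q)/I^{n+2}`, when `ker (A/I^{n+2} → A/I^{n+1}) = (ε)` with `ε ∈ 𝔪`: `ker π_U = (t♯_U)⁻¹(𝔪_n·Γ(X_n, t⁻¹U))`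
(F5a `ker_app_fibreEmb` at level `n`), and this preimage is `𝔪·Γ(X_{n+1}, U)` (level compatibility, `t♯_U` surjective with kernel `(ε) ⊆ 𝔪·Γ`).
[cite: GortzWedhorn2020, Example 4.36 (p. 139)] -/
theorem ker_traceHom {ε : A ⧸ I ^ (n + 1 + 1)} (hkert : RingHom.ker (infinitesimalNeighbourhood.transitionRingHom I n) = Ideal.span {ε})
    (hεm : ε ∈ (RingHom.ker q).map (Ideal.Quotient.mk (I ^ (n + 1 + 1)))) (U : (infinitesimalNeighbourhood I f (n + 1)).affineOpens) :
    RingHom.ker (traceHom I f n q hI hsq U) =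
      ((RingHom.ker q).map (Ideal.Quotient.mk (I ^ (n + 1 + 1)))).map
        (letI := chartAlg I f (n + 1) U; algebraMap (A ⧸ I ^ (n + 1 + 1)) Γ(infinitesimalNeighbourhood I f (n + 1), U)) := by
  haveI := isClosedImmersion_transition I f n
  letI := chartAlg I f (n + 1) U
  set V : (infinitesimalNeighbourhood I f n).affineOpens :=
    ⟨(infinitesimalNeighbourhood.transition I f n) ⁻¹ᵁ (U : (infinitesimalNeighbourhood I f (n + 1)).Opens), U.2.preimage _⟩ with hV
  letI := chartAlg I f n V
  set tU := ((infinitesimalNeighbourhood.transition I f n).app (U : (infinitesimalNeighbourhood I f (n + 1)).Opens)).hom with htU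
  set 𝔪₁ : Ideal (A ⧸ I ^ (n + 1 + 1)) := (RingHom.ker q).map (Ideal.Quotient.mk (I ^ (n + 1 + 1))) with h𝔪₁
  set 𝔪₀ : Ideal (A ⧸ I ^ (n + 1)) := (RingHom.ker q).map (Ideal.Quotient.mk (I ^ (n + 1))) with h𝔪₀
  -- the kernel of `(fibreEmb n)♯` on the chart `t⁻¹U` (level `n`)
  have hker₀ : RingHom.ker ((fibreEmb I f q hI hsq n).app (V : (infinitesimalNeighbourhood I f n).Opens)).hom =
      𝔪₀.map (algebraMap (A ⧸ I ^ (n + 1)) Γ(infinitesimalNeighbourhood I f n, V)) := by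
    rw [ker_app_fibreEmb I f q hI hsq hq n V, comap_hom_eq_map_inv, Ideal.map_map]
    rfl
  -- level compatibility and the image of `𝔪₁` under the reduction
  have hcomp := app_transition_comp_algebraMap I f n U
  have htr : 𝔪₁.map (infinitesimalNeighbourhood.transitionRingHom I n) = 𝔪₀ := by
    rw [h𝔪₁, Ideal.map_map, infinitesimalNeighbourhood.transitionRingHom_comp_mk]
  have himage : (𝔪₁.map (algebraMap (A ⧸ I ^ (n + 1 + 1)) Γ(infinitesimalNeighbourhood I f (n + 1), U))).map tU =
      𝔪₀.map (algebraMap (A ⧸ I ^ (n + 1)) Γ(infinitesimalNeighbourhood I f n, V)) := by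
    rw [Ideal.map_map, htU, hcomp, ← Ideal.map_map, htr]
  -- `ker π_U = tU⁻¹(ker (fibreEmb n)♯)`
  have hker : RingHom.ker (traceHom I f n q hI hsq U) = (RingHom.ker ((fibreEmb I f q hI hsq n).app (V : (infinitesimalNeighbourhood I f n).Opens)).hom).comap tU :=
    (RingHom.comap_ker _ _).symm
  have hsurj : Function.Surjective tU := by rw [htU]; exact (infinitesimalNeighbourhood.transition I f n).app_surjective _ U.2
  have hkert' : RingHom.ker tU = Ideal.span {algebraMap (A ⧸ I ^ (n + 1 + 1)) Γ(infinitesimalNeighbourhood I f (n + 1), U) ε} := by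
    rw [htU]; exact ker_app_transition_eq_span I f n hkert U
  rw [hker, hker₀, ← himage, Ideal.comap_map_of_surjective tU hsurj, ← RingHom.ker_eq_comap_bot, hkert']
  refine sup_eq_left.mpr ?_
  rw [Ideal.span_singleton_le_iff_mem]
  exact Ideal.mem_map_of_mem _ hεm

/-- **Restriction compatibility of `π`**: `π_{U'} ∘ res = res ∘ π_U` for affine `U' ≤ U` (naturality of `t♯` and `(fibreEmb n)♯`). [folklore] -/
theorem traceHom_res {U U' : (infinitesimalNeighbourhood I f (n + 1)).affineOpens} (hle : (U' : (infinitesimalNeighbourhood I f (n + 1)).Opens) ≤ U)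
    (a : Γ(infinitesimalNeighbourhood I f (n + 1), U)) :
    traceHom I f n q hI hsq U' ((infinitesimalNeighbourhood I f (n + 1)).presheaf.map (homOfLE hle).op a) =
      X₀.presheaf.map (homOfLE (((fibreEmb I f q hI hsq n).preimage_mono ((infinitesimalNeighbourhood.transition I f n).preimage_mono hle)))).op
        (traceHom I f n q hI hsq U a) := by
  have h1 := (infinitesimalNeighbourhood.transition I f n).naturality (homOfLE hle).op
  have h2 := (fibreEmb I f q hI hsq n).naturality
    ((Opens.map (infinitesimalNeighbourhood.transition I f n).base).map (homOfLE hle).op.unop).op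
  have e1 := congrArg (fun φ => φ.hom a) h1
  have e2 := congrArg (fun φ => φ.hom ((infinitesimalNeighbourhood.transition I f n).app (U : (infinitesimalNeighbourhood I f (n + 1)).Opens) a)) h2
  simp only [CommRingCat.hom_comp, RingHom.comp_apply] at e1 e2
  rw [traceHom_apply, traceHom_apply, e1, e2]
  rfl

variable {Yn Y₀ : Scheme.{0}} {jn : Yn ⟶ infinitesimalNeighbourhood I f n} {ι : Y₀ ⟶ X₀} {s₀ : Y₀ ⟶ Yn}
  (hs₀ : IsPullback s₀ ι (jn ≫ infinitesimalNeighbourhood.ι I f n) j₀)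

include hs₀ hq in
/-- **D4 for chart lifts: `π_U(J) = 𝓘_{Y₀}(e₀⁻¹U)`** (the chart clause pushed through `fibreEmb n`, F5a `map_app_fibreEmb_eq_ker_ideal`). [folklore] -/
theorem IsChartLift.map_traceHom [IsClosedImmersion jn] {U : (infinitesimalNeighbourhood I f (n + 1)).affineOpens}
    {J : Ideal Γ(infinitesimalNeighbourhood I f (n + 1), U)} (h : IsChartLift I f n jn U J) :
    haveI := isClosedImmersion_fibreEmb I f q hI hsq hq n
    haveI := isClosedImmersion_transition I f n
    J.map (traceHom I f n q hI hsq U) =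
      ι.ker.ideal ⟨fibreEmb I f q hI hsq n ⁻¹ᵁ ((infinitesimalNeighbourhood.transition I f n) ⁻¹ᵁ (U : (infinitesimalNeighbourhood I f (n + 1)).Opens)),
        (U.2.preimage _).preimage _⟩ := by
  haveI := isClosedImmersion_fibreEmb I f q hI hsq hq n
  haveI := isClosedImmersion_transition I f n
  rw [traceHom, ← Ideal.map_map, h.2, ← ker_ideal_chart (infinitesimalNeighbourhood.transition I f n) jn U]
  exact map_app_fibreEmb_eq_ker_ideal I f q hI hsq n hs₀ hq
    ⟨(infinitesimalNeighbourhood.transition I f n) ⁻¹ᵁ (U : (infinitesimalNeighbourhood I f (n + 1)).Opens), U.2.preimage _⟩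

end SpecialFibre

end Summit.ResolutionOfSingularities.ResolutionOfSingularities.Cruxes.EquisingularLiftNat.Sections

end
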